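import Literature.AlgebraicGeometry.Motives.AbelianVarietyCotangentSheafAtOrigin
import Literature.AlgebraicGeometry.HodgeTheory.CotangentSheafProductFormulaTransport
import Literature.AlgebraicGeometry.Motives.CotangentSheafProductFormula
import Literature.AlgebraicGeometry.Motives.AbelianVarietyTangentSheafFree
import Literature.AlgebraicGeometry.AbelianSchemes.AbelianSchemeOverBase
import HarnessLib

/-!
# The cotangent and tangent sheaves of a smooth group scheme over a LOCAL ring are free:
# `Ω¹_{G/R} ≅ 𝒪_G^d`, `𝒯_{G/R} ≅ 𝒪_G^d`; in particular for an abelian scheme of relative dimension `g`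

Layer `Literature/AlgebraicGeometry/GroupSchemes`; THEOREMS ONLY (no definition, no named fact, no instance, no
notation, no `sorry`).  Cell hodgecm-mathlib (D-0151), F-11 filler «LACK-3» of the smoothness census
(`B-provers/B-p13/g20/CENSUS-F11-Smoothness` §9 ∕ `B-provers/B-p04/g21/CENSUS-F11-A4b…`): «`Ω_{X₀/S₀}` (equivalently
`𝒯_{X₀/S₀}`) of an abelian scheme over a local Artin base is FREE» — the input `𝒯 ≅ 𝒪 ⊗ Lie` of rows A4a∕A4b (abelian
schemes are unobstructed; a deformation carrying a section is an abelian scheme).  Banked capital toward `stub_F11`;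
it proves nothing about HC_CM, which is proved only modulo the 7 printed citations until rung 0 closes.

PRINTED STATEMENT.  [BoschLutkebohmertRaynaud1990, §4.2 Prop. 2 (p. 100)]: for a group scheme `p : G → S` with unit
section `e`, `Ω¹_{G/S} ≅ p^* e^* Ω¹_{G/S}`; [GortzWedhorn2023, Prop. 27.15 and Rem. 27.18 (4)]: «in particular, if `S`
is the spectrum of a field, then `Ω¹_{G/S}` is a free `𝒪_G`-module».  The same «in particular» holds over the spectrum
of a LOCAL ring `R` as soon as `e^*Ω¹_{G/R}` is free — e.g. for `G → Spec R` smooth of relative dimension `d`, when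
`Ω¹_{G/R}` is locally free of rank `d` ([StacksProject, Tag 02G1]) and a frame near `e(𝔪)` pulls back along `e` to a
frame over the open `e⁻¹V ∋ 𝔪` of `Spec R`, which is all of `Spec R` because `R` is local.  For an abelian scheme
`A → Spec R` of relative dimension `g` this is [MumfordAV1970, §4 (iii) (p. 42)] «`Ω¹` is free, generated by the
invariant differentials» over a local base, and dually `𝒯_{A/R} = 𝓗om(Ω¹, 𝒪) ≅ 𝒪_A^g` ([Hartshorne1977, II.8 p. 180,
II Ex. 5.1 (b)]).

EVERY INPUT IS A TREE THEOREM (this file is glue):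
* ★ `HodgeTheory.nonempty_cotangentSheaf_iso_pullback_unit_of_productFormula` — BLR §4.2 Prop. 2
  `Ω¹_{G/k} ≅ π^* e^* Ω¹_{G/k}` for a group object `G` of `Over (Spec k)`, `k` ANY commutative ring, granted the
  product formula at `(fst, snd)`, which is ★ `Motives.isIso_biprod_desc_pullbackHom_fst_snd` (Görtz–Wedhorn II
  Cor. 17.32) for all `k`-schemes;
* ★ `Motives.exists_basis_sections_cotangentSheaf` — `Ω¹` of a `k`-scheme smooth of relative dimension `d` has a
  basis of `d` sections over an affine neighbourhood of any point (Stacks 02G1), `k` any ring;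
* ★ `Modules.nonempty_free_iso_over_of_basis`, ★ `KTheory.nonempty_restrictIso_of_overIso` ∕
  `nonempty_overIso_of_restrictIso` ∕ `nonempty_restrictPullbackIso` ∕ `nonempty_pullbackFreeIso`,
  ★ `Motives.nonempty_iso_free_of_overIso_of_eq_top` — frames, their pull-backs, «a frame over `⊤` is global»;
* Mathlib `IsLocalRing.closedPoint_mem_iff` — an open of `Spec R` (`R` local) containing the closed point is `⊤`;
* ★ `Modules.nonempty_dual_iso_free_of_iso_free` — the dual of a globally free module of finite rank is free.

## Main results (`R` a local ring, `G : Over (Spec R)` a group object, `[SmoothOfRelativeDimension d G.hom]`)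
* `GroupSchemes.unit_preimage_eq_top` — `e⁻¹V = ⊤` for every open `V ∋ e(𝔪)`.
* `GroupSchemes.nonempty_pullback_unit_cotangentSheaf_iso_free_of_card` — **`e^*Ω¹_{G/R} ≅ 𝒪_{Spec R}^I`**, `#I = d`.
* `GroupSchemes.nonempty_cotangentSheaf_iso_free_of_card` — **`Ω¹_{G/R} ≅ 𝒪_G^I`** (BLR ∘ the previous line).
* `GroupSchemes.nonempty_tangentSheaf_iso_free_of_card` — **`𝒯_{G/R} ≅ 𝒪_G^I`**.
* `…_fin` — the `Fin d` forms (base ring in `Type`, the currency of the tree's abelian-scheme files);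
* `AbelianSchemeOver.nonempty_cotangentSheaf_iso_free_of_isLocalRing`, `…tangentSheaf…`, `…pullback_unit…` — the
  `Fin g` forms for an abelian scheme `A` over `Spec R` (`R : Type` local) with `A.IsOfRelDim g`.

presearch: «Ω¹_{G/S} ≅ p^*e^*Ω free group scheme local base» → [cite: BoschLutkebohmertRaynaud1990, §4.2 Prop. 2] and
[corpus: book:gortz2023 p. 805] GW II Prop. 27.15 ∕ Rem. 27.18 (locators carried by the ★ inputs' docstrings); tree:
the field-case files `Motives/AbelianVarietyCotangentSheafAtOrigin`, `…CotangentSheafFreeHolds`, `…TangentSheafFree`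
(this file is their local-base edition; `rg "IsLocalRing" GroupSchemes/ HodgeTheory/Cotangent*` = 0 hits); Mathlib: no
scheme-level `Ω_{X/S}`.  playbook: none in payload.

## References
* [BoschLutkebohmertRaynaud1990] S. Bosch, W. Lütkebohmert, M. Raynaud, *Néron Models* (1990), §4.2 Prop. 2 (p. 100).
* [GortzWedhorn2023] U. Görtz, T. Wedhorn, *Algebraic Geometry II* (2023), Prop. 27.15, Rem. 27.18 (4), Cor. 17.32.
* [MumfordAV1970] D. Mumford, *Abelian Varieties* (1970), §4 (iii) (p. 42).
* [Hartshorne1977] R. Hartshorne, *Algebraic Geometry* (1977), II.8 (p. 180), II Ex. 5.1 (b) (p. 123), II §5 (p. 110).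
* [StacksProject] Tag 02G1.
-/

noncomputable section

open CategoryTheory CategoryTheory.Limits AlgebraicGeometry MonoidalCategory CartesianMonoidalCategory
open scoped MonObj

universe u

namespace Literature.AlgebraicGeometry.GroupSchemes

open Literature.AlgebraicGeometry.Motives Literature.AlgebraicGeometry.Modules Literature.AlgebraicGeometry.KTheory
open Literature.AlgebraicGeometry.HodgeTheory

-- `TopCat.Presheaf`/`Scheme.Modules` are not reducible (as in Mathlib's `AlgebraicGeometry/Modules` and the ★ inputs).
set_option backward.isDefEq.respectTransparency false

section LocalBase

variable {R : Type u} [CommRing R] [IsLocalRing R] (G : Over (Spec (CommRingCat.of R))) [GrpObj G]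

/-- **Over a local ring the unit section lands in every open around `e(𝔪)`: `e⁻¹V = Spec R`** — an open subset of
`Spec R` containing the closed point is everything (Mathlib `IsLocalRing.closedPoint_mem_iff`).
[cite: GortzWedhorn2023, Rem. 27.18 (4)] -/
theorem unit_preimage_eq_top {V : G.left.Opens}
    (hV : η[G].left.base (IsLocalRing.closedPoint R) ∈ V) : η[G].left ⁻¹ᵁ V = ⊤ :=
  (IsLocalRing.closedPoint_mem_iff _).mp hV

/-- **`e^*Ω¹_{G/R} ≅ 𝒪_{Spec R}^I` (`#I = d`) for a group scheme smooth of relative dimension `d` over a LOCAL ring**: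
`Ω¹_{G/R}` has a frame of size `d` on an affine neighbourhood `V` of `e(𝔪)` (Stacks 02G1), frames pull back along
`e`, and `e⁻¹V = Spec R`. [cite: BoschLutkebohmertRaynaud1990, §4.2 Prop. 2] [cite: StacksProject, Tag 02G1]
[cite: GortzWedhorn2023, Rem. 27.18 (4)] -/
theorem nonempty_pullback_unit_cotangentSheaf_iso_free_of_card (d : ℕ) [SmoothOfRelativeDimension d G.hom]
    {I : Type u} [Fintype I] (hI : Fintype.card I = d) :
    Nonempty ((Scheme.Modules.pullback η[G].left).obj (cotangentSheaf G) ≅ SheafOfModules.free I) := by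
  obtain ⟨V, hV, heV, I', hfin, hcard, ⟨b⟩⟩ :=
    exists_basis_sections_cotangentSheaf G d (η[G].left.base (IsLocalRing.closedPoint R))
  haveI := Fintype.ofFinite I'
  have eI : I' ≃ I := Fintype.equivOfCardEq (by rw [← Nat.card_eq_fintype_card, hcard, hI])
  -- the frame `𝒪^I ≅ Ω¹.over V` from the basis of `Γ(V, Ω¹)`
  obtain ⟨e₁⟩ := nonempty_free_iso_over_of_basis (cotangentSheaf G)
    (isAffineLocalizing_cotangentSheaf G) hV (b.reindex eI)
  -- frames pull back: `𝒪^I ≅ (e^*Ω¹).over (e⁻¹V)`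
  obtain ⟨e₂⟩ : Nonempty (SheafOfModules.free I ≅
      ((Scheme.Modules.pullback η[G].left).obj (cotangentSheaf G)).over (η[G].left ⁻¹ᵁ V)) := by
    obtain ⟨e'⟩ := nonempty_restrictIso_of_overIso e₁
    obtain ⟨f₁⟩ := nonempty_pullbackFreeIso (η[G].left ∣_ V) I
    obtain ⟨f₂⟩ := nonempty_restrictPullbackIso η[G].left V (cotangentSheaf G)
    exact nonempty_overIso_of_restrictIso
      (f₁.symm ≪≫ (Scheme.Modules.pullback (η[G].left ∣_ V)).mapIso e' ≪≫ f₂.symm)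
  exact nonempty_iso_free_of_overIso_of_eq_top _ (unit_preimage_eq_top G heV) e₂

/-- **`π^* e^* Ω¹_{G/R} ≅ 𝒪_G^I`** (`#I = d`): the right-hand side of Bosch–Lütkebohmert–Raynaud's
`Ω¹_{G/S} ≅ π^* e^* Ω¹_{G/S}` is free (`π^*𝒪^I ≅ 𝒪^I`). [cite: BoschLutkebohmertRaynaud1990, §4.2 Prop. 2] -/
theorem nonempty_pullback_hom_pullback_unit_cotangentSheaf_iso_free_of_card (d : ℕ)
    [SmoothOfRelativeDimension d G.hom] {I : Type u} [Fintype I] (hI : Fintype.card I = d) :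
    Nonempty ((Scheme.Modules.pullback G.hom).obj
      ((Scheme.Modules.pullback η[G].left).obj (cotangentSheaf G)) ≅ SheafOfModules.free I) := by
  obtain ⟨e⟩ := nonempty_pullback_unit_cotangentSheaf_iso_free_of_card G d hI
  obtain ⟨f⟩ := nonempty_pullbackFreeIso G.hom I
  exact ⟨(Scheme.Modules.pullback G.hom).mapIso e ≪≫ f⟩

/-- **`Ω¹_{G/R} ≅ 𝒪_G^I` (`#I = d`): the cotangent sheaf of a group scheme smooth of relative dimension `d` over a
LOCAL ring is free** — Bosch–Lütkebohmert–Raynaud §4.2 Prop. 2 `Ω¹ ≅ π^* e^* Ω¹` (★, from the product formula for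
`Ω¹` on `G ×_R G`, Görtz–Wedhorn II Cor. 17.32 ★) composed with `e^*Ω¹ ≅ 𝒪^I`.
[cite: BoschLutkebohmertRaynaud1990, §4.2 Prop. 2] [cite: GortzWedhorn2023, Prop. 27.15 and Rem. 27.18 (4)] -/
theorem nonempty_cotangentSheaf_iso_free_of_card (d : ℕ) [SmoothOfRelativeDimension d G.hom]
    {I : Type u} [Fintype I] (hI : Fintype.card I = d) :
    Nonempty (cotangentSheaf G ≅ SheafOfModules.free (R := G.left.ringCatSheaf) I) := by
  haveI := isIso_biprod_desc_pullbackHom_fst_snd G G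
  obtain ⟨e₁⟩ := nonempty_cotangentSheaf_iso_pullback_unit_of_productFormula G
  obtain ⟨e₂⟩ := nonempty_pullback_hom_pullback_unit_cotangentSheaf_iso_free_of_card G d hI
  exact ⟨e₁ ≪≫ e₂⟩

/-- **`𝒯_{G/R} ≅ 𝒪_G^I` (`#I = d`): the tangent sheaf `𝓗om(Ω¹_{G/R}, 𝒪_G)` of a group scheme smooth of relative
dimension `d` over a local ring is free** (dual of the free `Ω¹`). [cite: GortzWedhorn2023, Prop. 27.15 and Rem. 27.18 (4)]
[cite: Hartshorne1977, II.8 (p. 180) and II Ex. 5.1 (b) (p. 123)] -/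
theorem nonempty_tangentSheaf_iso_free_of_card (d : ℕ) [SmoothOfRelativeDimension d G.hom]
    {I : Type u} [Fintype I] (hI : Fintype.card I = d) :
    Nonempty (tangentSheaf G ≅ SheafOfModules.free (R := G.left.ringCatSheaf) I) := by
  obtain ⟨e⟩ := nonempty_cotangentSheaf_iso_free_of_card G d hI
  exact nonempty_dual_iso_free_of_iso_free e

end LocalBase

/-! ### Universe `0`: the `Fin d` forms -/

section FinForms

variable {R : Type} [CommRing R] [IsLocalRing R] (G : Over (Spec (CommRingCat.of R))) [GrpObj G]

/-- `Ω¹_{G/R} ≅ 𝒪_G^{Fin d}` (the `Fin` form, base ring in `Type`). [cite: BoschLutkebohmertRaynaud1990, §4.2 Prop. 2]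
[cite: GortzWedhorn2023, Prop. 27.15] -/
theorem nonempty_cotangentSheaf_iso_free_fin (d : ℕ) [SmoothOfRelativeDimension d G.hom] :
    Nonempty (cotangentSheaf G ≅ SheafOfModules.free (R := G.left.ringCatSheaf) (Fin d)) :=
  nonempty_cotangentSheaf_iso_free_of_card G d (Fintype.card_fin d)

/-- `𝒯_{G/R} ≅ 𝒪_G^{Fin d}` (the `Fin` form, base ring in `Type`). [cite: GortzWedhorn2023, Prop. 27.15 and Rem. 27.18 (4)] -/
theorem nonempty_tangentSheaf_iso_free_fin (d : ℕ) [SmoothOfRelativeDimension d G.hom] :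
    Nonempty (tangentSheaf G ≅ SheafOfModules.free (R := G.left.ringCatSheaf) (Fin d)) :=
  nonempty_tangentSheaf_iso_free_of_card G d (Fintype.card_fin d)

/-- `e^*Ω¹_{G/R} ≅ 𝒪_{Spec R}^{Fin d}` (the `Fin` form, base ring in `Type`). [cite: BoschLutkebohmertRaynaud1990, §4.2 Prop. 2]
[cite: StacksProject, Tag 02G1] -/
theorem nonempty_pullback_unit_cotangentSheaf_iso_free_fin (d : ℕ) [SmoothOfRelativeDimension d G.hom] :
    Nonempty ((Scheme.Modules.pullback η[G].left).obj (cotangentSheaf G) ≅ SheafOfModules.free (Fin d)) :=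
  nonempty_pullback_unit_cotangentSheaf_iso_free_of_card G d (Fintype.card_fin d)

end FinForms

end Literature.AlgebraicGeometry.GroupSchemes

/-! ### Abelian schemes of relative dimension `g` over a local ring -/

namespace Literature.AlgebraicGeometry.AbelianSchemes.AbelianSchemeOver

open Literature.AlgebraicGeometry.Motives Literature.AlgebraicGeometry.HodgeTheory
open Literature.AlgebraicGeometry.GroupSchemes

variable {R : Type} [CommRing R] [IsLocalRing R] (A : AbelianSchemeOver (Spec (CommRingCat.of R))) {g : ℕ}

/-- **`Ω¹_{A/R} ≅ 𝒪_A^g` for an abelian scheme of relative dimension `g` over a LOCAL ring** (e.g. an Artin local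
base): Mumford's «`Ω¹` is free, generated by the invariant differentials», over a local base.
[cite: MumfordAV1970, §4 (iii) (p. 42)] [cite: BoschLutkebohmertRaynaud1990, §4.2 Prop. 2] -/
theorem nonempty_cotangentSheaf_iso_free_of_isLocalRing (hA : A.IsOfRelDim g) :
    Nonempty (cotangentSheaf A.X ≅ SheafOfModules.free (R := A.X.left.ringCatSheaf) (Fin g)) :=
  haveI : SmoothOfRelativeDimension g A.X.hom := hA
  nonempty_cotangentSheaf_iso_free_fin A.X g

/-- **`𝒯_{A/R} ≅ 𝒪_A^g` (`𝒯 ≅ 𝒪 ⊗ Lie`) for an abelian scheme of relative dimension `g` over a LOCAL ring** — the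
input «`Ω_{X₀/S₀}` ∕ `𝒯_{X₀/S₀}` free over an Artin local base» of the F-11 rows A4a∕A4b.
[cite: MumfordAV1970, §4 (iii) (p. 42)] [cite: GortzWedhorn2023, Prop. 27.15 and Rem. 27.18 (4)] -/
theorem nonempty_tangentSheaf_iso_free_of_isLocalRing (hA : A.IsOfRelDim g) :
    Nonempty (tangentSheaf A.X ≅ SheafOfModules.free (R := A.X.left.ringCatSheaf) (Fin g)) :=
  haveI : SmoothOfRelativeDimension g A.X.hom := hA
  nonempty_tangentSheaf_iso_free_fin A.X g

/-- **`e^*Ω¹_{A/R} ≅ 𝒪_{Spec R}^g`** — the conormal module of the unit section (`Lie(A)^∨`) is free of rank `g` over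
the local base. [cite: BoschLutkebohmertRaynaud1990, §4.2 Prop. 2] [cite: StacksProject, Tag 02G1] -/
theorem nonempty_pullback_unit_cotangentSheaf_iso_free_of_isLocalRing (hA : A.IsOfRelDim g) :
    Nonempty ((Scheme.Modules.pullback η[A.X].left).obj (cotangentSheaf A.X) ≅ SheafOfModules.free (Fin g)) :=
  haveI : SmoothOfRelativeDimension g A.X.hom := hA
  nonempty_pullback_unit_cotangentSheaf_iso_free_fin A.X g

end Literature.AlgebraicGeometry.AbelianSchemes.AbelianSchemeOver

end
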